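import Summits.BirchSwinnertonDyer.BirchSwinnertonDyer.Theses.KatoDescentTamePotSupersingular
import Summits.BirchSwinnertonDyer.BirchSwinnertonDyer.Theorems.KatoDescentPotSupersingularReducibleKatoMemberOfFineInputsNoImai
import HarnessLib

/-!
# Crux M (K8-t′ `ReducibleKatoMember`), its HELD child 27962 `PublishedInputMemberHullZetaCore` and U₀-red's
# `PublishedInputKatoCorePackageU0RedT` BY NAME from {modularity, Fine, H2X⁺, Lim 3.5, FW} — NO IMAI
# (route `KatoDescentTamePotSupersingular`; seat `bsd-potss-rkm` g32)

Typed closers for tenure: the conclusions are the route's declarations BY NAME; the hypotheses are exactly the four NAMED Literature facts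
{`Kato2004.exists_memberHullZetaFineInputs` (hull sub-package, review-accepted p675944), `Kato2004.exists_iwasawaH2Data_fineSelmerDual_embedding_count`
(H2X⁺, p676034), `Lim2017.thm35_…`, `ferreroWashington1979_classicalMuVanishes`} (+ modularity `exists_isNewformOf` for M).  Compared with
the g30 closers (`FineInputsKT.*_of_fineInputs`, p678056) the displayed Imai schema `hImai` is GONE: Imai's finiteness is a tree theorem at every
potentially good odd prime (`TowerTorsionFiniteOrdinary.finite_fixedPoints_kerSubgroup_inf_decomp_of_padicValRat_j_nonneg`, this seat).
CONDITIONAL theorems (the four facts stay named; no `_holds` for Fine / H2X⁺ is expected — Kato's Euler system); they close nothing by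
themselves; BSD is proved for no curve.

References: [Kato2004Asterisque] Thm. 12.5–12.6 (pp. 221–222), Cor. 14.3, Thm. 14.5 (pp. 235–236), (14.9.1)–(14.9.3) (pp. 239–240),
§14.14 (p. 243), Prop. 14.16 (2) (pp. 244–245); [Imai1975] Theorem (p. 12); [BreuilConradDiamondTaylor2001] Thm. A.
-/

-- the summit and its single problem are both named `BirchSwinnertonDyer` (registry layout D-0017)
set_option linter.dupNamespace false
set_option autoImplicit false

noncomputable section

open Literature.NumberTheory.EllipticCurves Literature.NumberTheory.EllipticCurves.ModularForms
  Literature.NumberTheory.EllipticCurves.Kato2004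
open Summit.BirchSwinnertonDyer.BirchSwinnertonDyer.Theorems

namespace Summit.BirchSwinnertonDyer.BirchSwinnertonDyer.Theorems.FineInputsNoImaiKT

/-- **The HELD child 27962 `PublishedInputMemberHullZetaCore` (K8-t′) BY NAME from the hull sub-package, H2X⁺, Lim 3.5 and FW — no Imai.**
[cite: Kato2004Asterisque, Thm. 12.5 (3) (p. 222), (14.9.1) (p. 239), (14.9.3) (p. 240), §14.14 (14.14.1)–(14.14.2) (p. 243)] [cite: Imai1975, Theorem (p. 12)] -/
theorem publishedInputMemberHullZetaCore_of_fineInputs (hF : exists_memberHullZetaFineInputs)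
    (hH : exists_iwasawaH2Data_fineSelmerDual_embedding_count)
    (hLim : Lim2017.thm35_fineSelmerDual_moduleFinite_of_classicalMuVanishes_of_le_divisionField)
    (hFW : Literature.NumberTheory.IwasawaTheory.ferreroWashington1979_classicalMuVanishes) :
    Summit.BirchSwinnertonDyer.BirchSwinnertonDyer.Theses.KatoDescentTamePotSupersingular.PublishedInputMemberHullZetaCore :=
  FineInputsNoImai.exists_memberHullZetaCoreInputs_of_fineInputs hF hH hLim hFW

/-- **U₀-red's copy `PublishedInputKatoCorePackageU0RedT` (K8-t′, the same constant) BY NAME from the same four facts — no Imai.**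
[cite: Kato2004Asterisque, §14.14 (14.14.1)–(14.14.2) (p. 243), proof of Prop. 14.16 (2) (pp. 244–245)] [cite: Imai1975, Theorem (p. 12)] -/
theorem publishedInputKatoCorePackageU0RedT_of_fineInputs (hF : exists_memberHullZetaFineInputs)
    (hH : exists_iwasawaH2Data_fineSelmerDual_embedding_count)
    (hLim : Lim2017.thm35_fineSelmerDual_moduleFinite_of_classicalMuVanishes_of_le_divisionField)
    (hFW : Literature.NumberTheory.IwasawaTheory.ferreroWashington1979_classicalMuVanishes) :
    Summit.BirchSwinnertonDyer.BirchSwinnertonDyer.Theses.KatoDescentTamePotSupersingular.PublishedInputKatoCorePackageU0RedT :=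
  FineInputsNoImai.exists_memberHullZetaCoreInputs_of_fineInputs hF hH hLim hFW

/-- **Crux M (K8-t′ `ReducibleKatoMember`) from modularity, the hull sub-package, H2X⁺, Lim 3.5 and FW, Literature-constant form — no Imai,
no Gross–Zagier–Kolyvagin, no Poitou–Tate binder, no abstract `𝐇²`.**
[cite: Kato2004Asterisque, Thm. 12.5/12.6 (p. 222), Cor. 14.3, Thm. 14.5 (pp. 235–236), (14.9.1)–(14.9.3) (pp. 239–240), (14.14.1)–(14.14.2) (p. 243), Prop. 14.16 (2) (pp. 244–245)]
[cite: Imai1975, Theorem (p. 12)] [cite: Wuthrich2014, Lemma 14 (p. 396)] -/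
theorem tameReducibleKatoMember_of_newform_of_fineInputs (hmod : exists_isNewformOf)
    (hF : exists_memberHullZetaFineInputs) (hH : exists_iwasawaH2Data_fineSelmerDual_embedding_count)
    (hLim : Lim2017.thm35_fineSelmerDual_moduleFinite_of_classicalMuVanishes_of_le_divisionField)
    (hFW : Literature.NumberTheory.IwasawaTheory.ferreroWashington1979_classicalMuVanishes) :
    Summit.BirchSwinnertonDyer.BirchSwinnertonDyer.Theses.KatoDescentTamePotSupersingular.ReducibleKatoMember :=
  FineInputsNoImai.katoMemberShaBoundOfReducible_of_newform_of_fineInputs hmod hF hH hLim hFW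

/-- **Crux M (K8-t′) keyed to the live alias `PublishedInputNewformKatoZ` (20296)** and the four facts; the GZK child 20298 and the
Imai schema are both UNUSED. [cite: Kato2004Asterisque, Cor. 14.3, Thm. 14.5 (pp. 235–236), Prop. 14.16 (2) (pp. 244–245)]
[cite: BreuilConradDiamondTaylor2001, Thm. A] -/
theorem tameReducibleKatoMember_of_newformZ_of_fineInputs
    (hmod : Summit.BirchSwinnertonDyer.BirchSwinnertonDyer.Theses.KatoDescentTamePotSupersingular.PublishedInputNewformKatoZ)
    (hF : exists_memberHullZetaFineInputs) (hH : exists_iwasawaH2Data_fineSelmerDual_embedding_count)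
    (hLim : Lim2017.thm35_fineSelmerDual_moduleFinite_of_classicalMuVanishes_of_le_divisionField)
    (hFW : Literature.NumberTheory.IwasawaTheory.ferreroWashington1979_classicalMuVanishes) :
    Summit.BirchSwinnertonDyer.BirchSwinnertonDyer.Theses.KatoDescentTamePotSupersingular.ReducibleKatoMember :=
  tameReducibleKatoMember_of_newform_of_fineInputs hmod hF hH hLim hFW

/-- **Crux M (K8-t′) keyed to U₀-red's live modularity alias `PublishedInputModularityU0RedT`** and the four facts.
[cite: Kato2004Asterisque, Prop. 14.16 (2) (pp. 244–245)] [cite: BreuilConradDiamondTaylor2001, Thm. A] -/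
theorem tameReducibleKatoMember_of_modularityU0RedT_of_fineInputs
    (hmod : Summit.BirchSwinnertonDyer.BirchSwinnertonDyer.Theses.KatoDescentTamePotSupersingular.PublishedInputModularityU0RedT)
    (hF : exists_memberHullZetaFineInputs) (hH : exists_iwasawaH2Data_fineSelmerDual_embedding_count)
    (hLim : Lim2017.thm35_fineSelmerDual_moduleFinite_of_classicalMuVanishes_of_le_divisionField)
    (hFW : Literature.NumberTheory.IwasawaTheory.ferreroWashington1979_classicalMuVanishes) :
    Summit.BirchSwinnertonDyer.BirchSwinnertonDyer.Theses.KatoDescentTamePotSupersingular.ReducibleKatoMember :=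
  tameReducibleKatoMember_of_newform_of_fineInputs hmod hF hH hLim hFW

end Summit.BirchSwinnertonDyer.BirchSwinnertonDyer.Theorems.FineInputsNoImaiKT

end
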